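import Summits.BirchSwinnertonDyer.BirchSwinnertonDyer.Theorems.SchneiderFreeSocketsV2
import Summits.BirchSwinnertonDyer.Rank1Residual.X11b.TamagawaHeegnerExact
import Summits.BirchSwinnertonDyer.Rank1Residual.X11b.AnticyclotomicLinks
import Summits.BirchSwinnertonDyer.BirchSwinnertonDyer.Theorems.SchneiderFreeAdditiveX3StepLEquivBranch
import Literature.NumberTheory.EllipticCurves.BSDQuadraticDescentTorsionOddPartProofs
import HarnessLib
import HarnessLib.Audit.Tags

/-!
# Schneider-free additive X3 door — the UPPER sockets (co-T-B6-1, co-STEP L, the Manin-robust co-inputs)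
# and their EQUIVALENCE pair by pair given the control equality and Kolyvagin (Theses-free)

Cell `bsd-schneider-ideate`. Statements §§1–2 are the base unit's (planner P2 gen 13) kernel-checked
Sketch `memos/ROUTE-P2-upper-v1-g13-Sketch.lean` §§1–2 VERBATIM (memo `memos/ROUTE-P2-upper-v1-g13.md`,
U5–U7: the door's SECOND WING — the height-free UPPER half on the same cells), landed here by seat
`bsd-schneider-door-c5` (prover, gen 8) so that the mirror lemmas the memo asks for (U27) have tree types;
§§3–4 are those mirror lemmas (new). Predicates + elementary readings only; nothing asserted; BSD is not
advanced; no named fact is used (Kolyvagin enters §4 as an explicit hypothesis).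

The door (route `SchneiderFreeAdditiveX3`) types the LOWER half `ord_p #Ш(E)_an ≤ ord_p #Ш(E)` from
T-B6-1 `AdditiveIMCLowerBDPOnTreeLeAt` (`2·ord_p log_ω P ≤ n + 2s`), the control corner and Gross–Zagier
bookkeeping (`SchneiderFreeSocketsV2`). The second wing reads the SAME branch main conjecture in the
Kolyvagin direction `(L) ⊆ Ch_Λ(X)·R₀⟦T⟧` and pushes it through the SAME control EQUALITY:

* §1 `AdditiveIMCUpperBDPOnTreeLeAt p κ 𝔭 γ ι s P` — co-T-B6-1 at one frame: `n + 2s ≤ 2·ord_p log_ω P`;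
  `sha_le_index_of_additive_upper_links` (with the control EQUALITY:
  `ord_p #Ш(E/K)[p^∞] + ord_p ∏_{w∣N⁺} c_w + 2s ≤ 2·ord_p[E(K):ℤP]`), `charValuation_eq_of_lower_of_upper`.
* §2 `IndexUpperBoundLeAt W p K P s` — co-STEP L (`ord_p #Ш(E/K) + 2·ord_p ∏_ℓ c_ℓ + 2s ≤ 2·ord_p[E(K):ℤP]`),
  `index_eq_of_lower_of_upper`; the Manin-robust co-inputs `AdditiveCoStepLInputManinAt W p`,
  `AdditiveIMCUpperBDPInputManinAt W p` (binder-for-binder `AdditiveStepLInputManinAt` /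
  `AdditiveIMCLowerBDPInputManinAt` plus `E(K)[p] = 0`, which the Kolyvagin side needs).
* §3 (U27, mirror of `…StepLEquivBranch` §1) `indexUpperBoundLeAt_iff_of_heegner_of_shaFinite` — over a
  classical Heegner field with `Ш(E/K)` finite the two currencies of co-STEP L agree (Tamagawa transport
  for every `p`, `#Ш[p^∞] = p^{ord_p #Ш}`); hence co-STEP L + control at a frame ⟹ co-T-B6-1 there, and
  co-T-B6-1 + control at one frame ⟹ co-STEP L.
* §5–§6 (appended) `JointUpperBoundAt W Wd p` (mirror of `Typed.JointLowerBoundAt`) with its descents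
  (memo U8: + partner's LOWER half, or + `ord_p #Ш_an(Wd) ≤ 0` = the TWIST-UNIT lever); `TwistUnitHeegnerDataAt` (U10).
* §4 (U27, mirror of `…StepLEquivBranch` §2) on a pair `(W, p)`: given Kolyvagin's finiteness and the
  Manin-robust control input `AdditiveControlInputManinAt W p` (items 19295/19548's conclusion),
  **`additiveCoStepLInputManinAt_iff_imcUpperBDPInputManinAt_of_kolyvagin_of_control`** — co-STEP L♯ ⟺
  co-T-B6-1♯; so the second wing's analytic cruxes cost exactly co-STEP L, and a co-STEP-L census tests them.

References: [JetchevSkinnerWan2017] §7.3.1 (eq:tamK), §7.4.1 (arXiv:1512.06894 p. 30); [KellerYin2024b]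
arXiv:2410.23241 Thm. 3.5.1 (the equality whose Kolyvagin half the co-socket reads; preprint, not used
here); [Gross1991] Thm. 1.3; [GreenbergLNM1716] §1.
-/

noncomputable section

open scoped Classical

open WeierstrassCurve NumberField IsDedekindDomain Field Literature.NumberTheory.EllipticCurves
  Literature.NumberTheory.EllipticCurves.ModularForms
  Literature.NumberTheory.EllipticCurves.GreenbergSelmer
  Literature.NumberTheory.EllipticCurves.Rank1Residual
  Literature.NumberTheory.EllipticCurves.Rank1Residual.Typed
  Summit.BirchSwinnertonDyer.Rank1Residual
  Summit.BirchSwinnertonDyer.Rank1Residual.X11b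
  Summit.BirchSwinnertonDyer.Rank1Residual.X11b.AcSelmer
  Summit.BirchSwinnertonDyer.Rank1Residual.X11b.Halves

set_option linter.dupNamespace false
set_option autoImplicit false

namespace Summit.BirchSwinnertonDyer.BirchSwinnertonDyer.Theorems.SchneiderFree.Upper

/-! ### §1 co-T-B6-1 at one frame, with a Manin slack, and the bookkeeping with the control EQUALITY -/

/-- **co-T-B6-1 with slack `s` (the UPPER socket at one frame):** the characteristic power series of
`X_ac^∅(E/K_∞)` has `T`-adic valuation `n` with `n + 2s ≤ 2·ord_p log_ω y_K`. What the Kolyvagin/EQUALITY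
side of a branch main conjecture (`(L_𝔭^{BDP}) ⊆ Ch_Λ(X)·R₀⟦T⟧`) plus the branch value formula
`L(0) = u·(log_ω y_K / c)²` give at `s = v_p(c)`. A predicate; nothing asserted.
[cite: JetchevSkinnerWan2017, §7.4.1 (arXiv:1512.06894 p. 30)] [cite: KellerYin2024b, Thm. 3.5.1] -/
@[conjecture]
def AdditiveIMCUpperBDPOnTreeLeAt (p : ℕ) [Fact p.Prime] {K : Type} [Field K] [NumberField K]
    {W : WeierstrassCurve ℚ} [W.IsElliptic] [W.IsGloballyMinimal] (κ : ZpExtension K p)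
    (𝔭 : HeightOneSpectrum (𝓞 K)) (γ : Field.absoluteGaloisGroup K) [Fact (κ.IsTopGenerator γ)]
    (ι : K →+* ℚ_[p]) (s : ℕ) (P : (W.baseChange K).toAffine.Point) : Prop :=
  ∃ n : ℕ, XAc.HasCharValuationAt (W.baseChange K) p κ 𝔭 ∅ γ n ∧
    (n : ℤ) + 2 * (s : ℤ) ≤ 2 * X11b.padicLogOrd W p ι P

section Links

variable {p : ℕ} [Fact p.Prime] {K : Type} [Field K] [NumberField K]
  {W : WeierstrassCurve ℚ} [W.IsElliptic] [W.IsGloballyMinimal] {κ : ZpExtension K p}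
  {𝔭 : HeightOneSpectrum (𝓞 K)} {γ : Field.absoluteGaloisGroup K} [Fact (κ.IsTopGenerator γ)]
  {ι : K →+* ℚ_[p]}

/-- **Bookkeeping (kernel-checked), the mirror of `index_le_slack_of_additive_links`:** co-T-B6-1 at slack `s`
∧ the control EQUALITY T-B6-2′ at one frame give
`ord_p #Ш(E/K)[p^∞] + ord_p ∏_{w∣N⁺} c_w(E/K) + 2s ≤ 2·ord_p[E(K):ℤP]`. [folklore] -/
theorem sha_le_index_of_additive_upper_links {P : (W.baseChange K).toAffine.Point} {s : ℕ}
    (h1 : AdditiveIMCUpperBDPOnTreeLeAt p κ 𝔭 γ ι s P) (h2 : AdditiveControlOnTreeAt p κ 𝔭 γ ι P) :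
    (padicValNat p (Nat.card (AddCommGroup.primaryComponent (W.baseChange K).sha p)) : ℤ) +
        padicValNat p (X11b.tamagawaProductSplit W K) + 2 * (s : ℤ) ≤
      2 * (padicValNat p (AddSubgroup.zmultiples P).index : ℤ) := by
  obtain ⟨n, hn, hle⟩ := h1
  obtain ⟨n', hn', heq⟩ := h2
  obtain rfl : n = n' := hn.unique hn'
  omega

/-- Both sockets at one frame (T-B6-1 and co-T-B6-1 at the same slack) pin `n + 2s = 2·ord_p log` … no: they
give the two-sided bound `2·ord log − 2s ≤ n ≤ 2·ord log − 2s`, i.e. `n + 2s = 2·ord_p log_ω y_K`. [folklore] -/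
theorem charValuation_eq_of_lower_of_upper {P : (W.baseChange K).toAffine.Point} {s : ℕ}
    (h1 : AdditiveIMCLowerBDPOnTreeLeAt p κ 𝔭 γ ι s P) (h2 : AdditiveIMCUpperBDPOnTreeLeAt p κ 𝔭 γ ι s P) :
    ∃ n : ℕ, XAc.HasCharValuationAt (W.baseChange K) p κ 𝔭 ∅ γ n ∧
      (n : ℤ) + 2 * (s : ℤ) = 2 * X11b.padicLogOrd W p ι P := by
  obtain ⟨n, hn, hle⟩ := h1
  obtain ⟨n', hn', hle'⟩ := h2
  obtain rfl : n = n' := hn.unique hn'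
  exact ⟨n, hn, by omega⟩

end Links

/-! ### §2 co-STEP L and the Manin-robust UPPER inputs over the B6 data (mirrors of `SchneiderFreeSocketsV2`) -/

/-- **co-STEP L with slack `2s` (Ш/`∏c_ℓ` currency):** `ord_p #Ш(E/K) + 2·ord_p ∏_ℓ c_ℓ(E) + 2s ≤ 2·ord_p[E(K):ℤP]`.
The reverse of `IndexLowerBoundLeAt`. A predicate; nothing asserted. [cite: JetchevSkinnerWan2017, §7.4.1] -/
def IndexUpperBoundLeAt (W : WeierstrassCurve ℚ) (p : ℕ) (K : Type) [Field K] [NumberField K]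
    (P : (W.baseChange K).toAffine.Point) (s : ℕ) : Prop :=
  padicValNat p (W.baseChange K).shaOrder + 2 * padicValNat p W.tamagawaProduct + 2 * s ≤
    2 * padicValNat p (AddSubgroup.zmultiples P).index

/-- STEP L and co-STEP L at the same slack are the EXACT index formula. [folklore] -/
theorem index_eq_of_lower_of_upper {W : WeierstrassCurve ℚ} {p : ℕ} {K : Type} [Field K] [NumberField K]
    {P : (W.baseChange K).toAffine.Point} {s : ℕ} (h1 : IndexLowerBoundLeAt W p K P s)
    (h2 : IndexUpperBoundLeAt W p K P s) :
    2 * padicValNat p (AddSubgroup.zmultiples P).index =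
      padicValNat p (W.baseChange K).shaOrder + 2 * padicValNat p W.tamagawaProduct + 2 * s := by
  unfold IndexLowerBoundLeAt at h1; unfold IndexUpperBoundLeAt at h2; omega

/-- **co-T-B6-3♯ (co-STEP L over the B6 data, Manin-robust; OUR typed input for the upper wing).** Same binders
as `AdditiveStepLInputManinAt`, plus `E(K)[p] = 0` (the Kolyvagin side needs it; it restricts the Heegner
field, not the curve: `E(K)[p] = E(ℚ)[p] ⊕ E^{d_K}(ℚ)[p]` at odd `p`). A predicate; nothing asserted.
[cite: JetchevSkinnerWan2017, §7.4.1] [cite: KellerYin2024b, Thm. 3.5.1 and §3.3 ¶1] -/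
@[conjecture]
def AdditiveCoStepLInputManinAt (W : WeierstrassCurve ℚ) [W.IsElliptic] [W.IsGloballyMinimal] (p : ℕ)
    [Fact p.Prime] : Prop :=
  ∀ (N : ℕ) [NeZero N] (K : Type) [Field K] [NumberField K]
    (Dt : ModularParametrizationData W N) (H : HeegnerDatum N (NumberField.discr K)) (ι : K →+* ℂ)
    (P : (W.baseChange K).toAffine.Point),
    W.analyticRank = 1 → Additive.N10.Locus W p → W.conductorNorm ℤ = N → IsImaginaryQuadratic K →
    Odd (NumberField.discr K) → ¬ p ∣ Units.torsionOrder K → SatisfiesHeegnerHypothesis N K →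
    (W.quadraticTwist (NumberField.discr K : ℚ)).entireLFunction 1 ≠ 0 →
    WeierstrassCurve.Affine.Point.map ι.toRatAlgHom P = heegnerPointComplex Dt H →
    ¬ IsOfFinAddOrder P → (∀ Q : (W.baseChange K).toAffine.Point, p • Q = 0 → Q = 0) →
    IndexUpperBoundLeAt W p K P (padicValNat p Dt.c.natAbs)

/-- **co-T-B6-1♯ (the UPPER socket over the B6 data and every anticyclotomic frame, Manin slack).** A predicate;
nothing asserted. [cite: JetchevSkinnerWan2017, §7.4.1] [cite: KellerYin2024b, Thm. 3.5.1] -/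
@[conjecture]
def AdditiveIMCUpperBDPInputManinAt (W : WeierstrassCurve ℚ) [W.IsElliptic] [W.IsGloballyMinimal] (p : ℕ)
    [Fact p.Prime] : Prop :=
  ∀ (N : ℕ) [NeZero N] (K : Type) [Field K] [NumberField K]
    (Dt : ModularParametrizationData W N) (H : HeegnerDatum N (NumberField.discr K)) (ι : K →+* ℂ)
    (P : (W.baseChange K).toAffine.Point),
    W.analyticRank = 1 → Additive.N10.Locus W p → W.conductorNorm ℤ = N → IsImaginaryQuadratic K →
    Odd (NumberField.discr K) → ¬ p ∣ Units.torsionOrder K → SatisfiesHeegnerHypothesis N K →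
    (W.quadraticTwist (NumberField.discr K : ℚ)).entireLFunction 1 ≠ 0 →
    WeierstrassCurve.Affine.Point.map ι.toRatAlgHom P = heegnerPointComplex Dt H →
    ¬ IsOfFinAddOrder P → (∀ Q : (W.baseChange K).toAffine.Point, p • Q = 0 → Q = 0) →
    ∀ (κ : ZpExtension K p), κ.IsAnticyclotomic →
      ∀ (γ : Field.absoluteGaloisGroup K) [Fact (κ.IsTopGenerator γ)]
        (𝔭 : HeightOneSpectrum (𝓞 K)) (h𝔭 : ((p : ℕ) : 𝓞 K) ∈ 𝔭.asIdeal)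
        (he : 𝔭.asIdeal.ramificationIdx (𝓞 ℚ) = 1) (hf : 𝔭.asIdeal.inertiaDeg (𝓞 ℚ) = 1),
        AdditiveIMCUpperBDPOnTreeLeAt p κ 𝔭 γ (embAt K p 𝔭 h𝔭 he hf) (padicValNat p Dt.c.natAbs) P


/-! ### §3 One Heegner datum: the two currencies of co-STEP L agree (mirror of `…StepLEquivBranch` §1) -/

section Datum

variable {p : ℕ} [Fact p.Prime] {K : Type} [Field K] [NumberField K]
  {W : WeierstrassCurve ℚ} {N : ℕ} {P : (W.baseChange K).toAffine.Point} {s : ℕ}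

/-- **`IndexUpperBoundLeAt` in frame currency** (mirror of `indexLowerBoundLeAt_iff_of_heegner_of_shaFinite`).
Over a classical Heegner field `K` for `N_E` and with `Ш(E/K)` finite:
`ord_p #Ш(E/K) + 2·ord_p ∏_ℓ c_ℓ(E) + 2s ≤ 2·ord_p[E(K):ℤP] ⟺ ord_p #Ш(E/K)[p^∞] + ord_p ∏_{w∣N⁺} c_w(E/K) + 2s
≤ 2·ord_p[E(K):ℤP]` — Tamagawa transport for EVERY `p` (`ord_p ∏_{w∣N⁺} c_w = ord_p ∏_w c_w = 2·ord_p ∏_ℓ c_ℓ`)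
and `#Ш[p^∞] = p^{ord_p #Ш}` for finite `Ш`. [cite: JetchevSkinnerWan2017, §7.3.1 (eq:tamK) (arXiv:1512.06894 p. 30)] -/
theorem indexUpperBoundLeAt_iff_of_heegner_of_shaFinite [W.IsElliptic] (hN : W.conductorNorm ℤ = N)
    (hK : IsImaginaryQuadratic K) (hHe : SatisfiesHeegnerHypothesis N K)
    (hfin : (W.baseChange K).ShaFinite) :
    IndexUpperBoundLeAt W p K P s ↔
      (padicValNat p (Nat.card (AddCommGroup.primaryComponent (W.baseChange K).sha p)) : ℤ) +
          padicValNat p (X11b.tamagawaProductSplit W K) + 2 * (s : ℤ) ≤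
        2 * (padicValNat p (AddSubgroup.zmultiples P).index : ℤ) := by
  have htam1 := X11b.padicValNat_tamagawaProductSplit_eq_of_heegner_prime (p := p) W K hN hHe
  have htam2 := X11b.padicValNat_tamagawaProduct_baseChange_of_heegner_prime (p := p) W K hK hN hHe
  haveI : Finite (W.baseChange K).sha := hfin
  have hsha : padicValNat p (Nat.card (AddCommGroup.primaryComponent (W.baseChange K).sha p)) =
      padicValNat p (W.baseChange K).shaOrder := by
    rw [Literature.NumberTheory.EllipticCurves.natCard_primaryComponent_eq_pow_padicValNat p,
      padicValNat.prime_pow]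
    rfl
  rw [htam1, htam2, hsha]
  unfold IndexUpperBoundLeAt
  omega

variable [W.IsElliptic] [W.IsGloballyMinimal] {κ : ZpExtension K p} {𝔭 : HeightOneSpectrum (𝓞 K)}
  {γ : Field.absoluteGaloisGroup K} [Fact (κ.IsTopGenerator γ)] {ι : K →+* ℚ_[p]}

/-- **co-STEP L at the datum + the control equality at a frame ⟹ co-T-B6-1 (slack `s`) at that frame**
(`Ш(E/K)` finite, `K` a classical Heegner field for `N_E`): with `n = ord_p #Ш[p^∞] + 2(ord_p log_ω P −
ord_p[E(K):ℤP]) + ord_p ∏_{w∣N⁺} c_w` the index inequality is `n + 2s ≤ 2·ord_p log_ω P`.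
[cite: JetchevSkinnerWan2017, §7.4.1 (arXiv:1512.06894 p. 30)] -/
theorem additiveIMCUpperBDPOnTreeLeAt_of_indexUpperBoundLeAt_of_control (hN : W.conductorNorm ℤ = N)
    (hK : IsImaginaryQuadratic K) (hHe : SatisfiesHeegnerHypothesis N K)
    (hfin : (W.baseChange K).ShaFinite) (hI : IndexUpperBoundLeAt W p K P s)
    (h2 : AdditiveControlOnTreeAt p κ 𝔭 γ ι P) : AdditiveIMCUpperBDPOnTreeLeAt p κ 𝔭 γ ι s P := by
  have hI' := (indexUpperBoundLeAt_iff_of_heegner_of_shaFinite hN hK hHe hfin).mp hI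
  obtain ⟨n, hn, heq⟩ := h2
  exact ⟨n, hn, by omega⟩

/-- **co-T-B6-1 (slack `s`) + the control equality at ONE frame ⟹ co-STEP L at the datum** (the bookkeeping
`sha_le_index_of_additive_upper_links` read in `IndexUpperBoundLeAt` currency; `Ш(E/K)` finite).
[cite: JetchevSkinnerWan2017, §7.4.1 (arXiv:1512.06894 p. 30)] -/
theorem indexUpperBoundLeAt_of_imcUpperLe_of_control (hN : W.conductorNorm ℤ = N)
    (hK : IsImaginaryQuadratic K) (hHe : SatisfiesHeegnerHypothesis N K)
    (hfin : (W.baseChange K).ShaFinite) (h1 : AdditiveIMCUpperBDPOnTreeLeAt p κ 𝔭 γ ι s P)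
    (h2 : AdditiveControlOnTreeAt p κ 𝔭 γ ι P) : IndexUpperBoundLeAt W p K P s :=
  (indexUpperBoundLeAt_iff_of_heegner_of_shaFinite hN hK hHe hfin).mpr
    (sha_le_index_of_additive_upper_links h1 h2)

/-- **At one frame with the control equality, BOTH sockets (T-B6-1 and co-T-B6-1 at the same slack) ⟺ the
EXACT index formula** `2·ord_p[E(K):ℤP] = ord_p #Ш(E/K) + 2·ord_p ∏_ℓ c_ℓ + 2s` (`Ш(E/K)` finite, `K` a
classical Heegner field) — the currency in which a STEP-L census «with equality» is read.
[cite: JetchevSkinnerWan2017, §7.4.1 (arXiv:1512.06894 p. 30)] [cite: Gross1991, Conj. (2.2)] -/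
theorem index_eq_iff_lower_and_upper_of_control (hN : W.conductorNorm ℤ = N) (hK : IsImaginaryQuadratic K)
    (hHe : SatisfiesHeegnerHypothesis N K) (hfin : (W.baseChange K).ShaFinite)
    (h2 : AdditiveControlOnTreeAt p κ 𝔭 γ ι P) :
    2 * padicValNat p (AddSubgroup.zmultiples P).index =
        padicValNat p (W.baseChange K).shaOrder + 2 * padicValNat p W.tamagawaProduct + 2 * s ↔
      AdditiveIMCLowerBDPOnTreeLeAt p κ 𝔭 γ ι s P ∧ AdditiveIMCUpperBDPOnTreeLeAt p κ 𝔭 γ ι s P := by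
  constructor
  · intro h
    have hlow : IndexLowerBoundLeAt W p K P s := by unfold IndexLowerBoundLeAt; omega
    have hup : IndexUpperBoundLeAt W p K P s := by unfold IndexUpperBoundLeAt; omega
    have hlow' := (SchneiderFreeAdditiveX3.indexLowerBoundLeAt_iff_of_heegner_of_shaFinite
      (p := p) (P := P) (s := s) hN hK hHe hfin).mp hlow
    have hup' := (indexUpperBoundLeAt_iff_of_heegner_of_shaFinite hN hK hHe hfin).mp hup
    obtain ⟨n, hn, heq⟩ := h2
    exact ⟨⟨n, hn, by omega⟩, ⟨n, hn, by omega⟩⟩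
  · rintro ⟨h1, h1'⟩
    exact index_eq_of_lower_of_upper
      (SchneiderFreeAdditiveX3.indexLowerBoundLeAt_of_imcLowerLe_of_control hN hK hHe hfin h1 h2)
      (indexUpperBoundLeAt_of_imcUpperLe_of_control hN hK hHe hfin h1' h2)

end Datum

/-! ### §4 On a pair `(W, p)`: co-STEP L♯ ⟺ co-T-B6-1♯, given Kolyvagin and the control input (U27) -/

section Pair

variable {W : WeierstrassCurve ℚ} [W.IsElliptic] [W.IsGloballyMinimal] {p : ℕ} [Fact p.Prime]

/-- **co-STEP L♯ ⟹ co-T-B6-1♯ on a pair**, given Kolyvagin's finiteness of `Ш(E/K)` at non-torsion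
Heegner points of `W` and the Manin-robust control input `AdditiveControlInputManinAt W p` (the control
corner's conclusion): at EVERY datum with `E(K)[p] = 0` and EVERY frame, co-STEP L at that datum and the
control equality at that frame give the slack-`v_p(c)` co-socket.
[cite: JetchevSkinnerWan2017, §7.4.1 (arXiv:1512.06894 p. 30)] [cite: Gross1991, Thm. 1.3] -/
theorem additiveIMCUpperBDPInputManinAt_of_kolyvagin_of_control_of_coStepL
    (hKo : ∀ (N : ℕ) [NeZero N] (K : Type) [Field K] [NumberField K], kolyvagin N W K)
    (h4 : AdditiveControlInputManinAt W p) (hL : AdditiveCoStepLInputManinAt W p) :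
    AdditiveIMCUpperBDPInputManinAt W p := by
  intro N _ K _ _ Dt H ι P hr hloc hN hK hodd hunit hHe hLd hP hnt htf κ hκ γ _ 𝔭 h𝔭 he hf
  have hfin : (W.baseChange K).ShaFinite := (hKo N K hK hHe ⟨Dt, H, ι, hP⟩ hnt).2
  exact additiveIMCUpperBDPOnTreeLeAt_of_indexUpperBoundLeAt_of_control hN hK hHe hfin
    (hL N K Dt H ι P hr hloc hN hK hodd hunit hHe hLd hP hnt htf)
    (h4 N K Dt H ι P hr hloc hN hK hodd hunit hHe hLd hP hnt κ hκ γ 𝔭 h𝔭 he hf)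

/-- **co-T-B6-1♯ ⟹ co-STEP L♯ on a pair**, given Kolyvagin for `W` and the Manin-robust control input (a
frame exists: an anticyclotomic `ℤ_p`-extension with a topological generator,
`X11b.exists_anticyclotomic_generator_prime`, and a degree-one `𝔭 ∣ p` — `p` is additive, so `p ∣ N_E`
splits in the Heegner field). [cite: JetchevSkinnerWan2017, §7.4.1 (arXiv:1512.06894 p. 30)] [cite: Gross1991, Thm. 1.3] -/
theorem additiveCoStepLInputManinAt_of_kolyvagin_of_control_of_imcUpper
    (hKo : ∀ (N : ℕ) [NeZero N] (K : Type) [Field K] [NumberField K], kolyvagin N W K)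
    (h4 : AdditiveControlInputManinAt W p) (h1 : AdditiveIMCUpperBDPInputManinAt W p) :
    AdditiveCoStepLInputManinAt W p := by
  intro N _ K _ _ Dt H ι P hr hloc hN hK hodd hunit hHe hLd hP hnt htf
  have hp : p.Prime := Fact.out
  have hfin : (W.baseChange K).ShaFinite := (hKo N K hK hHe ⟨Dt, H, ι, hP⟩ hnt).2
  -- `p` is additive, so `p ∣ N_E`, so `p` splits in the Heegner field `K`
  have hpN : p ∣ W.conductorNorm ℤ :=
    (W.dvd_conductorNorm_iff_not_hasGoodReductionAtPrime p).mpr (not_good_of_addv W p hloc.2.1)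
  have hsplit : SplitsIn K p := hHe p hp (hN ▸ hpN)
  -- a frame: anticyclotomic `κ`, topological generator `γ`, degree-one `𝔭 ∣ p`
  obtain ⟨κ, γ, -, hκ, hγ, -⟩ := X11b.exists_anticyclotomic_generator_prime (p := p) hK
  haveI : Fact (κ.IsTopGenerator γ) := ⟨hγ⟩
  obtain ⟨𝔭, h𝔭, he, hf⟩ := X11b.exists_degreeOnePrime_of_splitsIn K p hK.1 hsplit
  exact indexUpperBoundLeAt_of_imcUpperLe_of_control hN hK hHe hfin
    (h1 N K Dt H ι P hr hloc hN hK hodd hunit hHe hLd hP hnt htf κ hκ γ 𝔭 h𝔭 he hf)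
    (h4 N K Dt H ι P hr hloc hN hK hodd hunit hHe hLd hP hnt κ hκ γ 𝔭 h𝔭 he hf)

/-- **co-STEP L♯ ⟺ co-T-B6-1♯ on every pair of the door, given Kolyvagin and the control input** (memo
`ROUTE-P2-upper-v1-g13.md` U27). Read on the second wing: under `PrintedFacts`' Kolyvagin conjunct and the
conclusion of the control corner (items 19295/19548, CLOSED), the co-STEP L input restricted to (M) is
EQUIVALENT to the (M) co-socket `PotMultBranchCoIMC`'s conclusion and restricted to (G-ord, `e = 2`) to
`GordTwoBranchCoIMC`'s — the wing's analytic cruxes are exactly as strong as co-STEP L, so a co-STEP-L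
census (the door's STEP-L census read «with equality»: kit j261157, j261255–66, j262088–98, all 1 091
instances at `p = 3` with EQUALITY) tests them. [cite: JetchevSkinnerWan2017, §7.4.1 (arXiv:1512.06894 p. 30)]
[cite: Gross1991, Thm. 1.3 and Conj. (2.2)] -/
theorem additiveCoStepLInputManinAt_iff_imcUpperBDPInputManinAt_of_kolyvagin_of_control
    (hKo : ∀ (N : ℕ) [NeZero N] (K : Type) [Field K] [NumberField K], kolyvagin N W K)
    (h4 : AdditiveControlInputManinAt W p) :
    AdditiveCoStepLInputManinAt W p ↔ AdditiveIMCUpperBDPInputManinAt W p :=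
  ⟨additiveIMCUpperBDPInputManinAt_of_kolyvagin_of_control_of_coStepL hKo h4,
    additiveCoStepLInputManinAt_of_kolyvagin_of_control_of_imcUpper hKo h4⟩

end Pair

/-! ### §5 (appended, door-c5 gen 8; P2 gen 13 Sketch §3 VERBATIM) The JOINT upper half over the pair `(E, E^{d_K})` and its two descents -/

/-- **JOINT upper half of BSD_p over a pair `(W, Wd)`** (mirror of `Typed.JointLowerBoundAt`):
`ord_p #Ш(W) + ord_p #Ш(Wd) ≤ ord_p #Ш_an(W) + ord_p #Ш_an(Wd)` with both analytic orders rational. The currency in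
which exact BSD_p over an imaginary quadratic `K` pays out. A predicate; nothing asserted.
[cite: Miller2011LMS, Def. 1.1 (arXiv:1010.2431 p. 3)] [cite: JetchevSkinnerWan2017, §7.4.1] -/
def JointUpperBoundAt (W Wd : WeierstrassCurve ℚ) (p : ℕ) : Prop :=
  ∃ q qd : ℚ, shaAn W = (q : ℂ) ∧ shaAn Wd = (qd : ℂ) ∧
    (padicValNat p W.shaOrder : ℤ) + (padicValNat p Wd.shaOrder : ℤ) ≤ padicValRat p q + padicValRat p qd

/-- **Descent 1 (bookkeeping): joint upper + the LOWER half of the partner ⟹ the UPPER half of `W`.**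
[cite: Miller2011LMS, Def. 1.1] -/
theorem missingUpperBoundAt_of_jointUpper_of_lower {W Wd : WeierstrassCurve ℚ} {p : ℕ}
    (hJ : JointUpperBoundAt W Wd p) (hL : MissingLowerBoundAt Wd p) : MissingUpperBoundAt W p := by
  obtain ⟨q, qd, hq, hqd, hle⟩ := hJ
  obtain ⟨qd', hqd', hl⟩ := hL
  have hqq : qd' = qd := by
    have : ((qd' : ℂ)) = (qd : ℂ) := by rw [← hqd', hqd]
    exact_mod_cast this
  subst hqq
  exact ⟨q, hq, by omega⟩

/-- **Descent 2 (bookkeeping) — the TWIST-UNIT lever:** joint upper + `ord_p #Ш_an(Wd) ≤ 0` ⟹ the UPPER half of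
`W` (as `0 ≤ ord_p #Ш(Wd)` trivially). This replaces the partner's r = 0 LOWER half (not in print on the cells)
by a CHOICE of the Heegner field. [cite: Miller2011LMS, Def. 1.1] -/
theorem missingUpperBoundAt_of_jointUpper_of_twistUnit {W Wd : WeierstrassCurve ℚ} {p : ℕ}
    (hJ : JointUpperBoundAt W Wd p) (hU : ∃ qd : ℚ, shaAn Wd = (qd : ℂ) ∧ padicValRat p qd ≤ 0) :
    MissingUpperBoundAt W p := by
  obtain ⟨q, qd, hq, hqd, hle⟩ := hJ
  obtain ⟨qd', hqd', hu⟩ := hU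
  have hqq : qd' = qd := by
    have : ((qd' : ℂ)) = (qd : ℂ) := by rw [← hqd', hqd]
    exact_mod_cast this
  subst hqq
  have h0 : (0 : ℤ) ≤ (padicValNat p Wd.shaOrder : ℤ) := by positivity
  exact ⟨q, hq, by omega⟩

/-- Joint upper + joint lower over the same pair = exact BSD_p for the pair's Ш-product. [folklore] -/
theorem sha_sum_eq_of_jointLower_of_jointUpper {W Wd : WeierstrassCurve ℚ} {p : ℕ}
    (hJ : JointLowerBoundAt W Wd p) (hJ' : JointUpperBoundAt W Wd p) :
    ∃ q qd : ℚ, shaAn W = (q : ℂ) ∧ shaAn Wd = (qd : ℂ) ∧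
      padicValRat p q + padicValRat p qd = (padicValNat p W.shaOrder : ℤ) + (padicValNat p Wd.shaOrder : ℤ) := by
  obtain ⟨q, qd, hq, hqd, hle⟩ := hJ
  obtain ⟨q', qd', hq', hqd', hle'⟩ := hJ'
  have h1 : q' = q := by
    have : ((q' : ℂ)) = (q : ℂ) := by rw [← hq', hq]
    exact_mod_cast this
  have h2 : qd' = qd := by
    have : ((qd' : ℂ)) = (qd : ℂ) := by rw [← hqd', hqd]
    exact_mod_cast this
  subst h1 h2
  exact ⟨q', qd', hq, hqd, le_antisymm hle hle'⟩

/-- The UPPER half of both curves gives the joint upper half (so the joint statement is WEAKER). [folklore] -/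
theorem jointUpper_of_upper_of_upper {W Wd : WeierstrassCurve ℚ} {p : ℕ}
    (h : MissingUpperBoundAt W p) (hd : MissingUpperBoundAt Wd p) : JointUpperBoundAt W Wd p := by
  obtain ⟨q, hq, hle⟩ := h
  obtain ⟨qd, hqd, hled⟩ := hd
  exact ⟨q, qd, hq, hqd, by omega⟩


/-! ### §6 (appended, door-c5 gen 8; P2 gen 13 Sketch §5 VERBATIM) The twist-unit Heegner datum at `(W, p)` -/

/-- **TWIST-UNIT Heegner datum at `(W, p)`** (the new lever): a Heegner field `K` for `N_E` with odd `d_K`,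
`p ∤ #𝓞_K^×`, `E(K)[p] = 0`, ANY parametrisation datum with its traced Heegner point (non-torsion), a globally
minimal model `Wd` of `E^{(d_K)}`, and `#Ш_an(E^{(d_K)})` a rational of NON-POSITIVE `p`-adic valuation
(`L(E^{d_K},1) ≠ 0` is kept explicitly: the junk value `padicValRat p 0 = 0` must not count). Per pair a
finite, exact certificate (modular symbols); class-wide a non-vanishing-mod-`p` statement for the quadratic
twists of a curve with reducible `E[p]` (Vatsal 1999 / Kriz–Li 2019 type) on Heegner discriminants.
A predicate; nothing asserted. [cite: Vatsal1999, Thm. 0.3] [cite: GrossZagier1986, Thm. I.(6.3)] -/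
def TwistUnitHeegnerDataAt (W : WeierstrassCurve ℚ) [W.IsElliptic] [W.IsGloballyMinimal] (p : ℕ)
    [Fact p.Prime] : Prop :=
  ∃ (N : ℕ) (_ : NeZero N) (K : Type) (_ : Field K) (_ : NumberField K)
    (Dt : ModularParametrizationData W N) (H : HeegnerDatum N (NumberField.discr K)) (ι : K →+* ℂ)
    (P : (W.baseChange K).toAffine.Point) (Wd : WeierstrassCurve ℚ) (_ : Wd.IsElliptic)
    (_ : Wd.IsGloballyMinimal),
    W.conductorNorm ℤ = N ∧ IsImaginaryQuadratic K ∧ Odd (NumberField.discr K) ∧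
    ¬ p ∣ Units.torsionOrder K ∧ SatisfiesHeegnerHypothesis N K ∧
    (W.quadraticTwist (NumberField.discr K : ℚ)).entireLFunction 1 ≠ 0 ∧
    WeierstrassCurve.Affine.Point.map ι.toRatAlgHom P = heegnerPointComplex Dt H ∧
    ¬ IsOfFinAddOrder P ∧ (∀ Q : (W.baseChange K).toAffine.Point, p • Q = 0 → Q = 0) ∧
    (∃ C : VariableChange ℚ, C • W.quadraticTwist (NumberField.discr K : ℚ) = Wd) ∧
    ∃ qd : ℚ, shaAn Wd = (qd : ℂ) ∧ padicValRat p qd ≤ 0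


end Summit.BirchSwinnertonDyer.BirchSwinnertonDyer.Theorems.SchneiderFree.Upper

end
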